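import Summits.Ventures.AbcSig.Rows.Bridge

/-!
# Venture AbcSig — bridge from REDUCED C2a cells (`Rows.C2aCellRed`, RULING H1) to p1's UNREDUCED census predicate `Rows.C2aCell`

HONEST FRAMING. COMPUTATION cell `pub-abcsig`; bookkeeping only (exponent reduction); no claim on ABC or any summit.
`Rows/Statements.lean` records: "`C2aCell ℓ aok R → C2aCellRed ℓ aok R` is immediate; the converse is the n-th-power absorption
argument (not formalised here)". THIS FILE formalises that converse, with the one subtlety made explicit: absorbing `n`-th powers
REDUCES THE 2-EXPONENT CLASS (`a ↦ a mod n`), so the converse holds cell-by-cell only for classes of BOUNDED exponents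
(`aok a → a < 11 ≤ n`, i.e. the census classes `a = 0, 1, 2, 3`, `a ∈ {4, 5}`, `a = 6`), while an UNBOUNDED class (`7 ≤ a`, `6 ≤ a`)
needs the reduced cells of ALL classes `0 ≤ a' < n` (same `ℓ`, same residual set `R`).

* `IsPrimitiveSolution.absorb` / `absorbA` — a primitive solution for `(A, B·cⁿ, C)` gives one for `(A, B, C)` with `y ↦ c·y`
  (for `n ≥ 1` the prime supports of `B·cⁿ·y` and `B·(c·y)` agree, so pairwise coprimality is inherited); symmetric in `A`.
* `C2a_reduce` — every primitive solution of a C2a cell datum `(A·B = 2^a·ℓ^m, n ∤ m)` yields one with REDUCED exponents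
  `(2^(a mod n)·ℓ^(m mod n))` in some coprime distribution, still with `x·y ≠ ±1`.
* `C2aCell_of_red` — bounded classes: `(∀ a, aok a → a < 11) → C2aCellRed ℓ aok R → C2aCell ℓ aok R`.
* `C2aCell_of_red_all` — any class: `C2aCellRed ℓ (fun _ => True) R → C2aCell ℓ aok R`.
* `C2aCellRed_all_of_classes` — the seven census classes `a = 0, 1, 2, 3, {4,5}, 6, ≥ 7` together give `C2aCellRed ℓ (fun _ => True) R`.
-/

namespace Summit.Ventures.AbcSig

/-- Absorbing an `n`-th power of the coefficient into the variable (`B·cⁿ·yⁿ = B·(c·y)ⁿ`): primitive solutions for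
`(A, B·cⁿ, C)` give primitive solutions for `(A, B, C)`; needs `n ≥ 1` so that `cⁿ` and `c` have the same prime support. -/
theorem IsPrimitiveSolution.absorb {A B C c n : ℕ} {x y z : ℤ} (hn : 0 < n)
    (h : IsPrimitiveSolution A (B * c ^ n) C n x y z) :
    IsPrimitiveSolution A B C n x ((c : ℤ) * y) z := by
  obtain ⟨heq, hx0, hy0, hz0, hxy, hxz, hyz⟩ := h
  push_cast at heq hy0 hxy hyz
  have key : (B : ℤ) * ((c : ℤ) * y) ^ n = (B : ℤ) * (c : ℤ) ^ n * y ^ n := by rw [mul_pow]; ring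
  refine ⟨by rw [key]; exact heq, hx0, ?_, hz0, ?_, hxz, ?_⟩
  · have hB : (B : ℤ) ≠ 0 := fun hB => hy0 (by rw [hB]; ring)
    have hc : (c : ℤ) ≠ 0 := fun hc => hy0 (by rw [hc, zero_pow hn.ne']; ring)
    have hy : y ≠ 0 := fun hy => hy0 (by rw [hy]; ring)
    exact mul_ne_zero hB (mul_ne_zero hc hy)
  · have hB : IsCoprime ((A : ℤ) * x) (B : ℤ) := hxy.of_mul_right_left.of_mul_right_left
    have hc : IsCoprime ((A : ℤ) * x) (c : ℤ) :=
      (IsCoprime.pow_right_iff hn).mp hxy.of_mul_right_left.of_mul_right_right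
    have hy : IsCoprime ((A : ℤ) * x) y := hxy.of_mul_right_right
    exact hB.mul_right (hc.mul_right hy)
  · have hB : IsCoprime (B : ℤ) ((C : ℤ) * z) := hyz.of_mul_left_left.of_mul_left_left
    have hc : IsCoprime (c : ℤ) ((C : ℤ) * z) :=
      (IsCoprime.pow_left_iff hn).mp hyz.of_mul_left_left.of_mul_left_right
    have hy : IsCoprime y ((C : ℤ) * z) := hyz.of_mul_left_right
    exact hB.mul_left (hc.mul_left hy)

/-- The same absorption on the `A`-side (`x ↦ c·x`). -/
theorem IsPrimitiveSolution.absorbA {A B C c n : ℕ} {x y z : ℤ} (hn : 0 < n)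
    (h : IsPrimitiveSolution (A * c ^ n) B C n x y z) :
    IsPrimitiveSolution A B C n ((c : ℤ) * x) y z :=
  (h.swap.absorb hn).swap

/-- `b^a = b^(a mod n) · (b^(a div n))ⁿ`. -/
theorem pow_eq_pow_mod_mul_pow_div (b a n : ℕ) : b ^ a = b ^ (a % n) * (b ^ (a / n)) ^ n := by
  conv_lhs => rw [← Nat.mod_add_div a n]
  rw [pow_add, pow_mul']

/-- A product `x·(c·y)` with `x, y ≠ 0` and `c ≥ 2` is not `±1`. -/
theorem mul_mul_ne_pm_one {x y c : ℤ} (hx : x ≠ 0) (hy : y ≠ 0) (hc : 2 ≤ c) :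
    x * (c * y) ≠ 1 ∧ x * (c * y) ≠ -1 := by
  have h2 : 2 ≤ |x * (c * y)| := by
    rw [abs_mul, abs_mul, abs_of_nonneg (by omega : (0 : ℤ) ≤ c)]
    have hx1 := Int.one_le_abs hx
    have hy1 := Int.one_le_abs hy
    have h3 : (2 : ℤ) * 1 ≤ c * |y| := mul_le_mul hc hy1 zero_le_one (by omega)
    have h4 : (1 : ℤ) * (2 * 1) ≤ |x| * (c * |y|) := mul_le_mul hx1 h3 (by norm_num) (abs_nonneg x)
    simpa using h4
  constructor
  · intro h; rw [h] at h2; norm_num at h2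
  · intro h; rw [h] at h2; norm_num at h2

/-- In a primitive solution both variables are nonzero. -/
theorem IsPrimitiveSolution.ne_zero {A B C n : ℕ} {x y z : ℤ} (h : IsPrimitiveSolution A B C n x y z) :
    x ≠ 0 ∧ y ≠ 0 :=
  ⟨fun hx => h.2.1 (by rw [hx, mul_zero]), fun hy => h.2.2.1 (by rw [hy, mul_zero])⟩

/-- **Exponent reduction for C2a data.** A primitive solution with `|xy| > 1` of `A xⁿ + B yⁿ = z²`, `A·B = 2^a·ℓ^m` coprime,
`n ≥ 1`, yields one (in some coprime distribution) for the REDUCED datum `A'·B' = 2^(a mod n)·ℓ^(m mod n)`, still with `|x'y'| > 1`. -/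
theorem C2a_reduce {ℓ n a m A B : ℕ} {x y z : ℤ} (hℓ : ℓ.Prime) (hℓ2 : ℓ ≠ 2) (hn : 0 < n)
    (hAB : Nat.Coprime A B) (hprod : A * B = 2 ^ a * ℓ ^ m)
    (h1 : x * y ≠ 1) (h2 : x * y ≠ -1) (hsol : IsPrimitiveSolution A B 1 n x y z) :
    ∃ A' B' : ℕ, ∃ x' y' : ℤ, Nat.Coprime A' B' ∧ A' * B' = 2 ^ (a % n) * ℓ ^ (m % n) ∧
      x' * y' ≠ 1 ∧ x' * y' ≠ -1 ∧ IsPrimitiveSolution A' B' 1 n x' y' z := by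
  -- the absorbed factors
  set c2 : ℕ := 2 ^ (a / n) with hc2
  set cl : ℕ := ℓ ^ (m / n) with hcl
  have hc2pos : 1 ≤ c2 := Nat.one_le_two_pow
  have hclpos : 1 ≤ cl := Nat.one_le_pow _ _ hℓ.pos
  have e2 : 2 ^ a = 2 ^ (a % n) * c2 ^ n := pow_eq_pow_mod_mul_pow_div 2 a n
  have el : ℓ ^ m = ℓ ^ (m % n) * cl ^ n := pow_eq_pow_mod_mul_pow_div ℓ m n
  have cop' : Nat.Coprime (2 ^ (a % n)) (ℓ ^ (m % n)) :=
    Nat.Coprime.pow _ _ ((Nat.coprime_primes Nat.prime_two hℓ).mpr (Ne.symm hℓ2))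
  -- size control after absorbing `c` into one variable
  have size : ∀ (u v : ℤ) (c : ℕ), u ≠ 0 → v ≠ 0 → 1 ≤ c → u * v ≠ 1 → u * v ≠ -1 →
      u * ((c : ℤ) * v) ≠ 1 ∧ u * ((c : ℤ) * v) ≠ -1 := by
    intro u v c hu hv hc huv1 huv2
    rcases Nat.eq_or_lt_of_le hc with hc1 | hc1
    · rw [← hc1]; push_cast; rw [one_mul]; exact ⟨huv1, huv2⟩
    · exact mul_mul_ne_pm_one hu hv (by exact_mod_cast hc1)
  rcases coprime_distributions hℓ hℓ2 hAB hprod with ⟨rfl, rfl⟩ | ⟨rfl, rfl⟩ | ⟨rfl, rfl⟩ | ⟨rfl, rfl⟩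
  · -- (1, 2^a ℓ^m): absorb c2·cl into y
    have hB : 2 ^ a * ℓ ^ m = (2 ^ (a % n) * ℓ ^ (m % n)) * (c2 * cl) ^ n := by rw [e2, el]; ring
    rw [hB] at hsol
    have hs := hsol.absorb hn
    obtain ⟨hx, hy⟩ := hsol.ne_zero
    obtain ⟨s1, s2⟩ := size x y (c2 * cl) hx hy (Nat.one_le_iff_ne_zero.mpr (by positivity)) h1 h2
    exact ⟨1, 2 ^ (a % n) * ℓ ^ (m % n), x, ((c2 * cl : ℕ) : ℤ) * y, Nat.coprime_one_left _, by ring, s1, s2, hs⟩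
  · -- (2^a ℓ^m, 1): swap, then as above
    have hB : 2 ^ a * ℓ ^ m = (2 ^ (a % n) * ℓ ^ (m % n)) * (c2 * cl) ^ n := by rw [e2, el]; ring
    rw [hB] at hsol
    have hs := hsol.swap.absorb hn
    obtain ⟨hx, hy⟩ := hsol.ne_zero
    obtain ⟨s1, s2⟩ := size y x (c2 * cl) hy hx (Nat.one_le_iff_ne_zero.mpr (by positivity)) (by rwa [mul_comm]) (by rwa [mul_comm])
    exact ⟨1, 2 ^ (a % n) * ℓ ^ (m % n), y, ((c2 * cl : ℕ) : ℤ) * x, Nat.coprime_one_left _, by ring, s1, s2, hs⟩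
  · -- (2^a, ℓ^m): absorb c2 into x and cl into y
    rw [e2, el] at hsol
    have hs := (hsol.absorb hn).absorbA hn
    obtain ⟨hx, hy⟩ := hsol.ne_zero
    obtain ⟨s1, s2⟩ := size x y cl hx hy hclpos h1 h2
    have hx' : (cl : ℤ) * y ≠ 0 := mul_ne_zero (by exact_mod_cast (by omega : cl ≠ 0)) hy
    obtain ⟨t1, t2⟩ := size ((cl : ℤ) * y) x c2 hx' hx hc2pos (by rwa [mul_comm]) (by rwa [mul_comm])
    refine ⟨2 ^ (a % n), ℓ ^ (m % n), (c2 : ℤ) * x, (cl : ℤ) * y, cop', rfl, ?_, ?_, hs⟩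
    · rw [mul_comm]; exact t1
    · rw [mul_comm]; exact t2
  · -- (ℓ^m, 2^a): swap to the previous case
    rw [e2, el] at hsol
    have hs := (hsol.swap.absorb hn).absorbA hn
    obtain ⟨hx, hy⟩ := hsol.ne_zero
    obtain ⟨s1, s2⟩ := size y x cl hy hx hclpos (by rwa [mul_comm]) (by rwa [mul_comm])
    have hx' : (cl : ℤ) * x ≠ 0 := mul_ne_zero (by exact_mod_cast (by omega : cl ≠ 0)) hx
    obtain ⟨t1, t2⟩ := size ((cl : ℤ) * x) y c2 hx' hy hc2pos (by rwa [mul_comm]) (by rwa [mul_comm])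
    refine ⟨2 ^ (a % n), ℓ ^ (m % n), (c2 : ℤ) * y, (cl : ℤ) * x, cop', rfl, ?_, ?_, hs⟩
    · rw [mul_comm]; exact t1
    · rw [mul_comm]; exact t2

/-- **Bridge for BOUNDED classes** (`a = 0, 1, 2, 3`, `a ∈ {4,5}`, `a = 6`): the reduced cell gives p1's unreduced cell. -/
theorem C2aCell_of_red (ℓ : ℕ) (hℓ : ℓ.Prime) (hℓ2 : ℓ ≠ 2) (aok : ℕ → Prop) (R : Finset ℕ)
    (hb : ∀ a, aok a → a < 11) (h : Rows.C2aCellRed ℓ aok R) : Rows.C2aCell ℓ aok R := by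
  intro n hn h11 hnℓ hR A B a m ha hm hnm hAB hprod x y z h1 h2 hsol
  have hn0 : 0 < n := by omega
  obtain ⟨A', B', x', y', hAB', hprod', h1', h2', hsol'⟩ := C2a_reduce hℓ hℓ2 hn0 hAB hprod h1 h2 hsol
  have ha' : a % n = a := Nat.mod_eq_of_lt (by have := hb a ha; omega)
  rw [ha'] at hprod'
  have hm1 : 1 ≤ m % n := Nat.one_le_iff_ne_zero.mpr (fun h0 => hnm (Nat.dvd_of_mod_eq_zero h0))
  have hmn : m % n < n := Nat.mod_lt m hn0
  exact h n hn h11 hnℓ hR A' B' a (m % n) ha (by have := hb a ha; omega) hm1 hmn hAB' hprod' x' y' z h1' h2' hsol'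

/-- **Bridge for ANY class**: if the reduced cells of ALL 2-exponent classes are closed (`C2aCellRed ℓ (fun _ => True) R`),
every unreduced cell `C2aCell ℓ aok R` holds. -/
theorem C2aCell_of_red_all (ℓ : ℕ) (hℓ : ℓ.Prime) (hℓ2 : ℓ ≠ 2) (aok : ℕ → Prop) (R : Finset ℕ)
    (h : Rows.C2aCellRed ℓ (fun _ => True) R) : Rows.C2aCell ℓ aok R := by
  intro n hn h11 hnℓ hR A B a m _ hm hnm hAB hprod x y z h1 h2 hsol
  have hn0 : 0 < n := by omega
  obtain ⟨A', B', x', y', hAB', hprod', h1', h2', hsol'⟩ := C2a_reduce hℓ hℓ2 hn0 hAB hprod h1 h2 hsol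
  have hm1 : 1 ≤ m % n := Nat.one_le_iff_ne_zero.mpr (fun h0 => hnm (Nat.dvd_of_mod_eq_zero h0))
  exact h n hn h11 hnℓ hR A' B' (a % n) (m % n) trivial (Nat.mod_lt a hn0) hm1 (Nat.mod_lt m hn0) hAB' hprod' x' y' z h1' h2' hsol'

/-- The seven census classes together cover every reduced 2-exponent. -/
theorem C2aCellRed_all_of_classes (ℓ : ℕ) (R : Finset ℕ)
    (h0 : Rows.C2aCellRed ℓ (fun a => a = 0) R) (h1 : Rows.C2aCellRed ℓ (fun a => a = 1) R)
    (h2 : Rows.C2aCellRed ℓ (fun a => a = 2) R) (h3 : Rows.C2aCellRed ℓ (fun a => a = 3) R)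
    (h45 : Rows.C2aCellRed ℓ (fun a => a = 4 ∨ a = 5) R) (h6 : Rows.C2aCellRed ℓ (fun a => a = 6) R)
    (h7 : Rows.C2aCellRed ℓ (fun a => 7 ≤ a) R) : Rows.C2aCellRed ℓ (fun _ => True) R := by
  intro n hn h11 hnℓ hR A B a m _ han hm hmn hAB hprod x y z hxy1 hxy2
  rcases Nat.lt_or_ge a 7 with ha | ha
  · interval_cases a
    · exact h0 n hn h11 hnℓ hR A B 0 m rfl han hm hmn hAB hprod x y z hxy1 hxy2
    · exact h1 n hn h11 hnℓ hR A B 1 m rfl han hm hmn hAB hprod x y z hxy1 hxy2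
    · exact h2 n hn h11 hnℓ hR A B 2 m rfl han hm hmn hAB hprod x y z hxy1 hxy2
    · exact h3 n hn h11 hnℓ hR A B 3 m rfl han hm hmn hAB hprod x y z hxy1 hxy2
    · exact h45 n hn h11 hnℓ hR A B 4 m (Or.inl rfl) han hm hmn hAB hprod x y z hxy1 hxy2
    · exact h45 n hn h11 hnℓ hR A B 5 m (Or.inr rfl) han hm hmn hAB hprod x y z hxy1 hxy2
    · exact h6 n hn h11 hnℓ hR A B 6 m rfl han hm hmn hAB hprod x y z hxy1 hxy2
  · exact h7 n hn h11 hnℓ hR A B a m ha han hm hmn hAB hprod x y z hxy1 hxy2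

end Summit.Ventures.AbcSig
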